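import Summits.QuantumFields.YangMills.Theorems.AllWindowsColdBoxGaussSideFourthMoment
import Summits.QuantumFields.YangMills.Theorems.AllWindowsColdBoxGaussSideCovarianceTransfer
import Summits.QuantumFields.YangMills.Theorems.AllWindowsColdBoxGaussSideLocalMoments
import Summits.QuantumFields.YangMills.Theorems.AllWindowsColdBoxGaussSideLocal
import Summits.QuantumFields.YangMills.Theorems.AllWindowsColdBoxTiltMomentsThresholds
import Summits.QuantumFields.YangMills.Theorems.AllWindowsColdBoxLineGaussToolkit
import Summits.QuantumFields.YangMills.Theorems.ColdBoxAllGroupsBulkAllGroupsDlrPlumbingG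
import Summits.QuantumFields.YangMills.Theorems.ColdBoxAllGroupsBulkAllGroupsKernelCovCoreMomentsG
import Summits.QuantumFields.YangMills.Theorems.ColdBoxAllGroupsBoxFloorAllGroupsGaussSideD
import Summits.QuantumFields.YangMills.Theorems.WeakCouplingRatesColdBoxGaussMoments
import Summits.QuantumFields.YangMills.Theorems.WeakCouplingRatesColdBoxDirichletShiftedMean
import Summits.QuantumFields.YangMills.Theorems.WeakCouplingRatesColdBoxDirichletRestrictedCov
import Summits.QuantumFields.YangMills.Theorems.WeakCouplingRatesColdBoxTiltBound
import Mathlib.Probability.Moments.Covariance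
import HarnessLib

/-!
# LINE-17 «hypercontractive second-order tilt expansion» on crux `AllWindowsColdBox.BoxMidWindowsSU22` (stmt-QuantumFields-24003):
# F(ii) of stub F `stub_gaussSideTerms` — the covariance clause (STUB-PLAN-E §5 F(ii))

`GaussSideTerms θ` (ii): eventually in `β`, for all `T ≤ ⌈β^θ⌉`, `|Cov_ν(obsF, obsG T) − ¾·boxDirCircSqCov ⌈β^θ⌉ T| ≤ K⌈β^θ⌉⁶/β`
(`ν = lineGauss θ β`).  **`gaussSide_covariance`** proves it by feeding the engine `abs_cov_lineGauss_sub_cov_gaussD_le`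
(`…GaussSideCovarianceTransfer`) with the per-plaquette package **`localDecomposition`** (observable bounded by `4β`; quadratic
surrogate `qObsD` even with `∫q⁴dγ ≤ 840D⁴`; odd local cubic term with `∫c⁴dγ ≤ min(1, 6⁴4¹²10395D⁶(16H)⁶/β²)`; quartic remainder with
`∫r²dγ ≤ 560²·16·105·D⁴(16H)⁴/β²`; E(0) `|q − f − c| ≤ r` on the event), the colour identity `cov_qObsD_gaussD_eq`
(`Cov_γ(q_F,q_G) = (D/4)·boxDirCircSqCov`), `dimE_rho2_eq_three` (`D = 3`) and `centre_mem_plaquettesTouching`.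

No definition; standard axioms.  HONEST LABEL: one third of the OPEN registered stub F of one critic-PASSed line on the R2ξ″ RECORD-rung
crux 24003; no stub by name, no crux, rung or summit; the Yang–Mills mass gap is NOT proved by this file.
-/

set_option autoImplicit false

noncomputable section

open MeasureTheory ProbabilityTheory Finset
open scoped Matrix Matrix.Norms.Frobenius
open Literature.MathematicalPhysics.QuantumLattice
open Literature.MathematicalPhysics.QuantumFieldTheory
open Literature.MathematicalPhysics.QuantumFieldTheory.LatticeMaxwell
open Summit.QuantumFields.YangMills.Theorems.WeakCouplingRates
open Summit.QuantumFields.YangMills.Theorems.ColdBoxAllGroups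
open Summit.QuantumFields.YangMills.Theorems.FreeEnergyLogCoefficient

namespace Summit.QuantumFields.YangMills.Theorems.AllWindowsColdBoxBoxMidLine

/-- **The local decomposition package of ONE plaquette `(x,1,2)` touching the cold box** (eventually in `β`, `0 < θ ≤ 1/16`;
`H = ⌈β^θ⌉`, `γ = gaussD H D`): the observable `f = β·plaqCostAt` is measurable and bounded by `4β`; its quadratic surrogate
`q = qObsD (x,1,2)` is measurable, even, with `∫q⁴dγ ≤ 840D⁴`; and there are a local cubic term `c` (odd, `∫c⁴dγ ≤ 1` and
`≤ 6⁴4¹²10395·D⁶(16H)⁶/β²`) and a quartic remainder `r` (`∫r²dγ ≤ 560²·16·105·D⁴(16H)⁴/β²`) with `|q − f − c| ≤ r` on the event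
`lineEvent θ β` (E(0) `abs_qObsD_sub_beta_mul_plaqCostAt_sub_cubic_le`). -/
theorem localDecomposition {θ : ℝ} (hθ : 0 < θ) (hθ16 : θ ≤ 1 / 16) :
    ∃ β₀ : ℝ, ∀ β : ℝ, β₀ ≤ β → ∀ x : Literature.Probability.LatticeModels.Site 4,
      ((x, ⟨((1 : Fin 4), (2 : Fin 4)), by decide⟩) : ZdPlaquette 4) ∈ plaquettesTouching (AxialGauge.boxEdges 4 (2 * ⌈β ^ θ⌉₊ + 1)) →
      (Measurable fun t : TSpaceD ⌈β ^ θ⌉₊ (dimE ρ₂) => β * plaqCostAt ρ₂ x 1 2 (cfgTE ρ₂ ⌈β ^ θ⌉₊ β t)) ∧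
      (∀ t : TSpaceD ⌈β ^ θ⌉₊ (dimE ρ₂), |β * plaqCostAt ρ₂ x 1 2 (cfgTE ρ₂ ⌈β ^ θ⌉₊ β t)| ≤ 4 * β) ∧
      Measurable (qObsD ⌈β ^ θ⌉₊ (dimE ρ₂) (x, 1, 2)) ∧
      (∀ t, qObsD ⌈β ^ θ⌉₊ (dimE ρ₂) (x, 1, 2) (-t) = qObsD ⌈β ^ θ⌉₊ (dimE ρ₂) (x, 1, 2) t) ∧
      Integrable (fun t => qObsD ⌈β ^ θ⌉₊ (dimE ρ₂) (x, 1, 2) t ^ 4) (gaussD ⌈β ^ θ⌉₊ (dimE ρ₂)) ∧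
      ∫ t, qObsD ⌈β ^ θ⌉₊ (dimE ρ₂) (x, 1, 2) t ^ 4 ∂(gaussD ⌈β ^ θ⌉₊ (dimE ρ₂)) ≤ 840 * (dimE ρ₂ : ℝ) ^ 4 ∧
      ∃ c r : TSpaceD ⌈β ^ θ⌉₊ (dimE ρ₂) → ℝ,
        AEStronglyMeasurable c (gaussD ⌈β ^ θ⌉₊ (dimE ρ₂)) ∧ (∀ t, c (-t) = -c t) ∧
        Integrable (fun t => c t ^ 4) (gaussD ⌈β ^ θ⌉₊ (dimE ρ₂)) ∧
        ∫ t, c t ^ 4 ∂(gaussD ⌈β ^ θ⌉₊ (dimE ρ₂)) ≤ 1 ∧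
        ∫ t, c t ^ 4 ∂(gaussD ⌈β ^ θ⌉₊ (dimE ρ₂)) ≤ 6 ^ 4 * 4 ^ 12 * 10395 * (dimE ρ₂ : ℝ) ^ 6 * (16 * (⌈β ^ θ⌉₊ : ℝ)) ^ 6 / β ^ 2 ∧
        Integrable (fun t => r t ^ 2) (gaussD ⌈β ^ θ⌉₊ (dimE ρ₂)) ∧
        ∫ t, r t ^ 2 ∂(gaussD ⌈β ^ θ⌉₊ (dimE ρ₂)) ≤ 560 ^ 2 * 16 * 105 * (dimE ρ₂ : ℝ) ^ 4 * (16 * (⌈β ^ θ⌉₊ : ℝ)) ^ 4 / β ^ 2 ∧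
        ∀ t ∈ lineEvent θ β, |qObsD ⌈β ^ θ⌉₊ (dimE ρ₂) (x, 1, 2) t - β * plaqCostAt ρ₂ x 1 2 (cfgTE ρ₂ ⌈β ^ θ⌉₊ β t) - c t| ≤ r t := by
  haveI : SecondCountableTopology (Matrix (Fin 2) (Fin 2) ℂ) := inferInstanceAs (SecondCountableTopology (Fin 2 → Fin 2 → ℂ))
  haveI : SecondCountableTopology SU2 := inferInstance
  have hρc : Continuous ρ₂ := continuous_fundamentalRep (Fin 2)
  have hinj : Function.Injective ρ₂ := fundamentalRep_injective (Fin 2)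
  have hρu : ∀ g, ρ₂ g ∈ Matrix.unitaryGroup (Fin 2) ℂ := fundamentalRep_mem_unitaryGroup
  obtain ⟨β₁, hpack⟩ := eventually_lineGauss_package hθ hθ16 (k := 1) le_rfl
  obtain ⟨β₂, hthr⟩ := eventually_expClauseThresholds hθ hθ16 (r₂ := 1) (C₂ := 0) (K₁ := 0) one_pos le_rfl le_rfl
  obtain ⟨β₃, hthr4⟩ := eventually_fourthMomentThresholds hθ hθ16
  refine ⟨max (max β₁ β₂) β₃, fun β hβ x hx => ?_⟩
  obtain ⟨hβ1, -, -, -, -, -⟩ := hpack β (le_trans (le_max_left _ _) ((le_max_left _ _).trans hβ))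
  obtain ⟨-, hR4, -, -, -, -, -, -, -⟩ := hthr β (le_trans (le_max_right _ _) ((le_max_left _ _).trans hβ))
  obtain ⟨-, hc4, -⟩ := hthr4 β ((le_max_right _ _).trans hβ)
  have hβ0 : 0 < β := by linarith
  have hHr : (1 : ℝ) ≤ (⌈β ^ θ⌉₊ : ℝ) := (one_le_ceil_rpow_and_le hβ1 hθ.le).1
  have hH : 1 ≤ ⌈β ^ θ⌉₊ := by exact_mod_cast hHr
  have hES : ∀ t ∈ lineEvent θ β, ∀ e, ‖unscaleTE ⌈β ^ θ⌉₊ (dimE ρ₂) β t e‖ ≤ 2 * etaOf β ⌈β ^ θ⌉₊ (epsOf θ) :=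
    fun t ht e => ht.2 e
  -- the observable
  have hfm : Measurable fun t : TSpaceD ⌈β ^ θ⌉₊ (dimE ρ₂) => β * plaqCostAt ρ₂ x 1 2 (cfgTE ρ₂ ⌈β ^ θ⌉₊ β t) :=
    ((measurable_plaqCostAt_of_continuous ρ₂ hρc x 1 2).comp (measurable_cfgTE ρ₂ hρc hinj β)).const_mul β
  have hfb : ∀ t : TSpaceD ⌈β ^ θ⌉₊ (dimE ρ₂), |β * plaqCostAt ρ₂ x 1 2 (cfgTE ρ₂ ⌈β ^ θ⌉₊ β t)| ≤ 4 * β := by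
    intro t
    rw [abs_mul, abs_of_pos hβ0]
    have h := abs_plaqCostAt_leG ρ₂ hρu x 1 2 (cfgTE ρ₂ ⌈β ^ θ⌉₊ β t)
    norm_num at h
    nlinarith
  -- the quadratic surrogate
  have hq4 := integral_quadObs_pow_four_piD_le (H := ⌈β ^ θ⌉₊) (D := dimE ρ₂) (fun _ => (0 : ℝ)) ((x, 1, 2) : Plaq 4)
  simp only [zero_add, zero_pow (by norm_num : 8 ≠ 0)] at hq4
  obtain ⟨hq4I, hq4le⟩ := hq4
  have hK1 : boxDirProjKernel ⌈β ^ θ⌉₊ ((x, 1, 2) : Plaq 4) (x, 1, 2) ≤ 1 := by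
    have h := integral_dirCirc_sq_le_one_of_touching (H := ⌈β ^ θ⌉₊) hx
    rw [integral_dirCirc_sq] at h; exact h
  have hK0 : 0 ≤ boxDirProjKernel ⌈β ^ θ⌉₊ ((x, 1, 2) : Plaq 4) (x, 1, 2) := boxDirProjKernel_self_nonneg _
  have hqle : ∫ t, qObsD ⌈β ^ θ⌉₊ (dimE ρ₂) (x, 1, 2) t ^ 4 ∂(gaussD ⌈β ^ θ⌉₊ (dimE ρ₂)) ≤ 840 * (dimE ρ₂ : ℝ) ^ 4 := by
    refine hq4le.trans ?_
    rw [Finset.sum_const, Finset.card_univ, Fintype.card_fin, nsmul_eq_mul]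
    have hK4 : boxDirProjKernel ⌈β ^ θ⌉₊ ((x, 1, 2) : Plaq 4) (x, 1, 2) ^ 4 ≤ 1 := pow_le_one₀ hK0 hK1
    have hD0 : (0 : ℝ) ≤ (dimE ρ₂ : ℝ) := Nat.cast_nonneg _
    nlinarith [pow_nonneg hD0 3, pow_nonneg hD0 4, mul_nonneg (pow_nonneg hD0 4) (sub_nonneg.2 hK4)]
  -- the local cubic term and the quartic remainder
  obtain ⟨c, hc⟩ : ∃ c : TSpaceD ⌈β ^ θ⌉₊ (dimE ρ₂) → ℝ, c = fun t =>
      β * ((chartCubic ρ₂ (circV (extZero (unscaleTE ⌈β ^ θ⌉₊ (dimE ρ₂) β t)) (x, 1, 2)) (extZero (unscaleTE ⌈β ^ θ⌉₊ (dimE ρ₂) β t) (x, 1))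
            (extZero (unscaleTE ⌈β ^ θ⌉₊ (dimE ρ₂) β t) (x + Pi.single 1 1, 2)) -
          chartCubic ρ₂ (circV (extZero (unscaleTE ⌈β ^ θ⌉₊ (dimE ρ₂) β t)) (x, 1, 2)) (extZero (unscaleTE ⌈β ^ θ⌉₊ (dimE ρ₂) β t) (x, 1))
            (extZero (unscaleTE ⌈β ^ θ⌉₊ (dimE ρ₂) β t) (x + Pi.single 2 1, 1)) -
          chartCubic ρ₂ (circV (extZero (unscaleTE ⌈β ^ θ⌉₊ (dimE ρ₂) β t)) (x, 1, 2)) (extZero (unscaleTE ⌈β ^ θ⌉₊ (dimE ρ₂) β t) (x, 1))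
            (extZero (unscaleTE ⌈β ^ θ⌉₊ (dimE ρ₂) β t) (x, 2)) -
          chartCubic ρ₂ (circV (extZero (unscaleTE ⌈β ^ θ⌉₊ (dimE ρ₂) β t)) (x, 1, 2)) (extZero (unscaleTE ⌈β ^ θ⌉₊ (dimE ρ₂) β t) (x + Pi.single 1 1, 2))
            (extZero (unscaleTE ⌈β ^ θ⌉₊ (dimE ρ₂) β t) (x + Pi.single 2 1, 1)) -
          chartCubic ρ₂ (circV (extZero (unscaleTE ⌈β ^ θ⌉₊ (dimE ρ₂) β t)) (x, 1, 2)) (extZero (unscaleTE ⌈β ^ θ⌉₊ (dimE ρ₂) β t) (x + Pi.single 1 1, 2))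
            (extZero (unscaleTE ⌈β ^ θ⌉₊ (dimE ρ₂) β t) (x, 2)) +
          chartCubic ρ₂ (circV (extZero (unscaleTE ⌈β ^ θ⌉₊ (dimE ρ₂) β t)) (x, 1, 2)) (extZero (unscaleTE ⌈β ^ θ⌉₊ (dimE ρ₂) β t) (x + Pi.single 2 1, 1))
            (extZero (unscaleTE ⌈β ^ θ⌉₊ (dimE ρ₂) β t) (x, 2))) / 2) := ⟨_, rfl⟩
  obtain ⟨r, hr⟩ : ∃ r : TSpaceD ⌈β ^ θ⌉₊ (dimE ρ₂) → ℝ, r = fun t => 560 * β * (‖extZero (unscaleTE ⌈β ^ θ⌉₊ (dimE ρ₂) β t) (x, 1)‖ ^ 4 +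
      ‖extZero (unscaleTE ⌈β ^ θ⌉₊ (dimE ρ₂) β t) (x + Pi.single 1 1, 2)‖ ^ 4 + ‖extZero (unscaleTE ⌈β ^ θ⌉₊ (dimE ρ₂) β t) (x + Pi.single 2 1, 1)‖ ^ 4 +
      ‖extZero (unscaleTE ⌈β ^ θ⌉₊ (dimE ρ₂) β t) (x, 2)‖ ^ 4) := ⟨_, rfl⟩
  have hcm : AEStronglyMeasurable c (gaussD ⌈β ^ θ⌉₊ (dimE ρ₂)) := by
    rw [hc]; exact (continuous_localCubic (H := ⌈β ^ θ⌉₊) x β).measurable.aestronglyMeasurable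
  have hco : ∀ t, c (-t) = -c t := fun t => by rw [hc]; exact localCubic_neg (H := ⌈β ^ θ⌉₊) x β t
  have hcb : ∀ t, |c t| ≤ 6 * β * (‖extZero (unscaleTE ⌈β ^ θ⌉₊ (dimE ρ₂) β t) (x, 1)‖ +
      ‖extZero (unscaleTE ⌈β ^ θ⌉₊ (dimE ρ₂) β t) (x + Pi.single 1 1, 2)‖ + ‖extZero (unscaleTE ⌈β ^ θ⌉₊ (dimE ρ₂) β t) (x + Pi.single 2 1, 1)‖ +
      ‖extZero (unscaleTE ⌈β ^ θ⌉₊ (dimE ρ₂) β t) (x, 2)‖) ^ 3 := fun t => by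
    rw [hc]; exact abs_localCubic_le ρ₂ hβ0.le (extZero (unscaleTE ⌈β ^ θ⌉₊ (dimE ρ₂) β t)) x 1 2
  obtain ⟨hcI, hc4le⟩ := integral_pow_four_le_of_cubic_leg_bound (D := dimE ρ₂) hH hβ0 x 1 2 hcm hcb
  obtain ⟨⟨hrI', hr2le⟩, -⟩ := integral_remainder_moments_le (H := ⌈β ^ θ⌉₊) (D := dimE ρ₂) hH hβ0 x 1 2
  have hrI : Integrable (fun t => r t ^ 2) (gaussD ⌈β ^ θ⌉₊ (dimE ρ₂)) := by rw [hr]; exact hrI'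
  have hrle : ∫ t, r t ^ 2 ∂(gaussD ⌈β ^ θ⌉₊ (dimE ρ₂)) ≤ 560 ^ 2 * 16 * 105 * (dimE ρ₂ : ℝ) ^ 4 * (16 * (⌈β ^ θ⌉₊ : ℝ)) ^ 4 / β ^ 2 := by
    rw [hr]; exact hr2le
  have hdec : ∀ t ∈ lineEvent θ β, |qObsD ⌈β ^ θ⌉₊ (dimE ρ₂) (x, 1, 2) t - β * plaqCostAt ρ₂ x 1 2 (cfgTE ρ₂ ⌈β ^ θ⌉₊ β t) - c t| ≤ r t := by
    intro t ht
    have h4 : ∀ e, ‖unscaleTE ⌈β ^ θ⌉₊ (dimE ρ₂) β t e‖ ≤ 1 / 4 := fun e => (hES t ht e).trans hR4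
    rw [hc, hr]; exact abs_qObsD_sub_beta_mul_plaqCostAt_sub_cubic_le ρ₂ hρc hβ0 t h4 x 1 2
  exact ⟨hfm, hfb, ColdBoxAllGroups.measurable_qObsD (H := ⌈β ^ θ⌉₊) (dimE ρ₂) ((x, 1, 2) : Plaq 4),
    fun t => qObsD_neg (H := ⌈β ^ θ⌉₊) (dimE ρ₂) ((x, 1, 2) : Plaq 4) t, hq4I, hqle,
    c, r, hcm, hco, hcI, hc4le.trans hc4, hc4le, hrI, hrle, hdec⟩

/-- **F(ii) of `GaussSideTerms θ`** (`0 < θ ≤ 1/16`): eventually in `β`, for all `T ≤ ⌈β^θ⌉`,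
`|Cov_ν(obsF, obsG T) − ¾·boxDirCircSqCov ⌈β^θ⌉ T| ≤ K·⌈β^θ⌉⁶/β` with
`K = 16⁴·K₀(840D⁴, 6⁴4¹²10395D⁶, 560²·16·105·D⁴)` (`K₀` of `abs_cov_lineGauss_sub_cov_gaussD_le`).
Proof: the engine `abs_cov_lineGauss_sub_cov_gaussD_le` on the two packages `localDecomposition` (both plaquettes touch the box,
`centre_mem_plaquettesTouching`), the colour identity `cov_qObsD_gaussD_eq` (`Cov_γ(q_F, q_G) = (D/4)·boxDirCircSqCov`) and `D = dimE ρ₂ = 3`. -/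
theorem gaussSide_covariance {θ : ℝ} (hθ : 0 < θ) (hθ16 : θ ≤ 1 / 16) :
    ∃ K β₀ : ℝ, 0 ≤ K ∧ ∀ β : ℝ, β₀ ≤ β → ∀ T : ℕ, T ≤ ⌈β ^ θ⌉₊ →
      |((∫ t, obsF θ β t * obsG θ β T t ∂(lineGauss θ β)) -
          (∫ t, obsF θ β t ∂(lineGauss θ β)) * (∫ t, obsG θ β T t ∂(lineGauss θ β))) -
        3 / 4 * boxDirCircSqCov ⌈β ^ θ⌉₊ T| ≤ K * (⌈β ^ θ⌉₊ : ℝ) ^ 6 / β := by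
  have hD0 : (0 : ℝ) ≤ (dimE ρ₂ : ℝ) := Nat.cast_nonneg _
  have hA4 : (0 : ℝ) ≤ 840 * (dimE ρ₂ : ℝ) ^ 4 := by positivity
  have hCc4 : (0 : ℝ) ≤ 6 ^ 4 * 4 ^ 12 * 10395 * (dimE ρ₂ : ℝ) ^ 6 := by positivity
  have hCr2 : (0 : ℝ) ≤ 560 ^ 2 * 16 * 105 * (dimE ρ₂ : ℝ) ^ 4 := by positivity
  obtain ⟨β₁, hloc⟩ := localDecomposition hθ hθ16
  obtain ⟨β₂, heng⟩ := abs_cov_lineGauss_sub_cov_gaussD_le hθ hθ16 hA4 hCc4 hCr2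
  obtain ⟨β₃, hpack⟩ := eventually_lineGauss_package hθ hθ16 (k := 1) le_rfl
  refine ⟨((2 + 2 * (840 * (dimE ρ₂ : ℝ) ^ 4) + 6 * (1 + (1 + 840 * (dimE ρ₂ : ℝ) ^ 4) / 2) ^ 2) +
      2 * (3 + 840 * (dimE ρ₂ : ℝ) ^ 4 + 12 * (1 + (1 + 840 * (dimE ρ₂ : ℝ) ^ 4) / 2)) +
      3 * (1 / 2 + 6 ^ 4 * 4 ^ 12 * 10395 * (dimE ρ₂ : ℝ) ^ 6) + 4 * ((1 + 840 * (dimE ρ₂ : ℝ) ^ 4) / 2) +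
      4 * (560 ^ 2 * 16 * 105 * (dimE ρ₂ : ℝ) ^ 4)) * 16 ^ 4, max (max β₁ β₂) β₃, by positivity, fun β hβ T hT => ?_⟩
  have hβ₁ : β₁ ≤ β := le_trans (le_max_left _ _) ((le_max_left _ _).trans hβ)
  have hβ₂ : β₂ ≤ β := le_trans (le_max_right _ _) ((le_max_left _ _).trans hβ)
  obtain ⟨hβ1, -, -, -, -, -⟩ := hpack β ((le_max_right _ _).trans hβ)
  have hβ0 : 0 < β := by linarith
  have hHr : (1 : ℝ) ≤ (⌈β ^ θ⌉₊ : ℝ) := (one_le_ceil_rpow_and_le hβ1 hθ.le).1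
  have hH : 1 ≤ ⌈β ^ θ⌉₊ := by exact_mod_cast hHr
  obtain ⟨hxm, hym⟩ := centre_mem_plaquettesTouching hH hT
  obtain ⟨hfm, hfb, hqfm, hqfe, hqf4, hqf4le, cf, rf, hcfm, hcfo, hcf4, hcf1, hcf4le, hrf2, hrf2le, hdf⟩ := hloc β hβ₁ _ hxm
  obtain ⟨hgm, hgb, hqgm, hqge, hqg4, hqg4le, cg, rg, hcgm, hcgo, hcg4, hcg1, hcg4le, hrg2, hrg2le, hdg⟩ := hloc β hβ₁ _ hym
  have key := heng β hβ₂ (4 * β) _ _ _ _ cf cg rf rg hfm hgm hfb hgb hqfm hqgm hqfe hqge hqf4 hqg4 hqf4le hqg4le hcfm hcgm hcfo hcgo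
    hcf4 hcg4 hcf1 hcg1 hcf4le hcg4le hrf2 hrg2 hrf2le hrg2le hdf hdg
  -- the Gaussian main term: `Cov_γ(q_F, q_G) = (D/4)·boxDirCircSqCov = ¾·boxDirCircSqCov`
  have hmain := cov_qObsD_gaussD_eq (D := dimE ρ₂) hH hT
  have h34 : (dimE ρ₂ : ℝ) / 4 = 3 / 4 := by rw [dimE_rho2_eq_three]; norm_num
  rw [h34] at hmain
  simp only [plaq12At] at hmain
  unfold obsF obsG
  rw [← hmain]
  refine key.trans ?_
  have hS : (16 * (⌈β ^ θ⌉₊ : ℝ)) ^ 4 / β ≤ 16 ^ 4 * ((⌈β ^ θ⌉₊ : ℝ) ^ 6 / β) := by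
    rw [mul_pow, mul_div_assoc]
    refine mul_le_mul_of_nonneg_left (div_le_div_of_nonneg_right ?_ hβ0.le) (by norm_num)
    calc (⌈β ^ θ⌉₊ : ℝ) ^ 4 = (⌈β ^ θ⌉₊ : ℝ) ^ 4 * 1 := (mul_one _).symm
      _ ≤ (⌈β ^ θ⌉₊ : ℝ) ^ 4 * (⌈β ^ θ⌉₊ : ℝ) ^ 2 := mul_le_mul_of_nonneg_left (one_le_pow₀ hHr) (by positivity)
      _ = (⌈β ^ θ⌉₊ : ℝ) ^ 6 := by ring
  have hK0 : (0 : ℝ) ≤ (2 + 2 * (840 * (dimE ρ₂ : ℝ) ^ 4) + 6 * (1 + (1 + 840 * (dimE ρ₂ : ℝ) ^ 4) / 2) ^ 2) +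
      2 * (3 + 840 * (dimE ρ₂ : ℝ) ^ 4 + 12 * (1 + (1 + 840 * (dimE ρ₂ : ℝ) ^ 4) / 2)) +
      3 * (1 / 2 + 6 ^ 4 * 4 ^ 12 * 10395 * (dimE ρ₂ : ℝ) ^ 6) + 4 * ((1 + 840 * (dimE ρ₂ : ℝ) ^ 4) / 2) +
      4 * (560 ^ 2 * 16 * 105 * (dimE ρ₂ : ℝ) ^ 4) := by positivity
  calc _ ≤ _ := mul_le_mul_of_nonneg_left hS hK0
    _ = _ := by ring

end Summit.QuantumFields.YangMills.Theorems.AllWindowsColdBoxBoxMidLine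

end
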